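import Literature.NumberTheory.EllipticCurves.Smith2016.CongruentNumberSmithMatrixSelmer
import Literature.NumberTheory.EllipticCurves.CongruentNumberMonskySelmerParityEven
import Literature.NumberTheory.EllipticCurves.CongruentNumberEvenMonskySelmerExact
import HarnessLib

/-!
# The curve side of Smith's Theorem 1.2 for EVERY square-free `n`, in Monsky's matrices: `#Sel⁽²⁾(E⁽ⁿ⁾/ℚ) = 4 ⟺ det M = 1 ⟺ rank E⁽ⁿ⁾(ℚ) = 0 ∧ Ш(E⁽ⁿ⁾/ℚ)[2^∞] = 0` (odd and even `n`), and `det M = 0` for `n ≡ 5, 6, 7 (mod 8)` — PROVED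

Topic `NumberTheory/EllipticCurves`, namespace `Literature.NumberTheory.EllipticCurves.Smith2016`.
A pure proof file (theorems only), companion of `CongruentNumberSmithMatrixSelmer` (which treats Smith's
`M₁` for `n ≡ 1 (mod 4)`): here the same equivalences are stated with MONSKY'S OWN matrices `M` (odd `n`,
`HeathBrown1994.monskyMatrixOdd`) and `M` (even `n`, `monskyMatrixEven`), with NO residue hypothesis.  This is the
shape in which rows `2` and `3` of Smith's Table 1 are consumed (`CongruentNumberGenusDeterminantRowsTwoThree`):
Smith, §2 proof of Thm. 1.2 (chunk p0005 L65–L75): "Per Monsky's calculations in [Heat94],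
`rk(Sel⁽²⁾(E⁽ⁿ⁾)) = 2 + crnk(M₁)` for `n ≡ 1 (8)`, `= 2 + crnk(M₂)` for `n ≡ 2 (8)`, and
`= 1 + crnk(M₃[[2r],[2r]])` for `n ≡ 3 (8)` … `M₃[[2r],[2r]]` has rank two less than `M₃`" — so in every row
`crnk(M_x) = s(n) = crnk`(Monsky's matrix), i.e. over `𝔽₂` `det M_x = det M` (`= [s(n) = 0]`).

## What is proved (every `k`; `p : Fin k → ℕ` distinct odd primes)

* `monskySelmerRankOdd_eq_zero_iff_det`, `monskySelmerRankEven_eq_zero_iff_det` — `s(n) = 0 ⟺ det M = 1`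
  (`n = ∏ pᵢ` resp. `2∏ pᵢ`; `det = 1 ⟺` full rank over `𝔽₂`, `det_eq_one_iff_rank_eq_card`);
* **`card_selmerGroup_two_eq_four_iff_det_monskyMatrixOdd / Even`** — `#Sel⁽²⁾(E⁽ⁿ⁾/ℚ) = 4 ⟺ det M = 1`
  (Monsky's formula WITH EQUALITY, tree theorems `monsky_card_selmerGroup_two_odd/even_holds`);
* **`rank_zero_and_sha_iff_det_monskyMatrixOdd / Even`** — `rank E⁽ⁿ⁾(ℚ) = 0 ∧ Ш(E⁽ⁿ⁾/ℚ)[2^∞] = 0 ⟺ det M = 1`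
  (the exact descent count both ways, `card_selmerGroup_two_eq_four_iff_rank_zero_and_sha`);
* `det_monskyMatrixOdd_eq_zero_of_mod_eight`, `det_monskyMatrixEven_eq_zero_of_mod_eight_six` — for
  `n ≡ 5, 7 (mod 8)` resp. `n ≡ 6 (mod 8)` the determinant vanishes (Monsky's parity theorem, `s(n)` odd; tree
  theorems `odd_monskySelmerRankOdd_iff`, `odd_monskySelmerRankEven_iff`): "for `n ≡ 5, 6, 7 (8)` … the
  `2`-Selmer rank is odd … so both sides of Conjecture 1.1 fail" (chunk p0005 L75).

Cell `bsd-monsky` (prover-B g17).  AI provenance: written by an AI assistant; no human has reviewed it.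

## References
* [Smith2016CongruentDensity] A. Smith, arXiv:1603.08479v2, §1 Conj. 1.1 / Thm. 1.2 (chunk p0003 L9–L31),
  §2 proof of Thm. 1.2 (chunk p0005 L65–L75).
* [HeathBrown1994SelmerCongruentII] Appendix (Monsky), typescript p. 39 L10–L33 (odd `D`), p. 41 L20–L36
  (even `D`), Theorem p. 38 L5–L7 (parity).
* [TianYuanZhang2017] Asian J. Math. 21 (2017), Thm. 1.2 (journal numbering).
* [SilvermanAEC2009] Thm. X.4.2.
-/

open scoped Classical

open Matrix Finset
open Literature.NumberTheory.EllipticCurves.HeathBrown1994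
open Literature.NumberTheory.EllipticCurves.MonskySelmerParity
open Literature.NumberTheory.EllipticCurves.CongruentNumberMonskySelmer

namespace Literature.NumberTheory.EllipticCurves.Smith2016

variable {k : ℕ} (p : Fin k → ℕ)

/-! ## §1 `s(n) = 0 ⟺ det M = 1` (odd and even Monsky matrices; no residue hypothesis) -/

/-- **`s(n) = 0 ⟺ det M = 1`**, odd `n = p₁⋯p_k`, Monsky's `M = (A + D₂, D₂; D₂, A + D₋₂)`.
[cite: HeathBrown1994SelmerCongruentII, Appendix (Monsky), typescript p. 39 L27–L33]
[cite: Smith2016CongruentDensity, §2 proof of Thm. 1.2 (chunk p0005 L65–L75)] -/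
theorem monskySelmerRankOdd_eq_zero_iff_det :
    monskySelmerRankOdd p = 0 ↔ (monskyMatrixOdd p).det = 1 := by
  rw [monskySelmerRankOdd, det_eq_one_iff_rank_eq_card, Fintype.card_sum, Fintype.card_fin]
  have h := Matrix.rank_le_card_width (monskyMatrixOdd p)
  rw [Fintype.card_sum, Fintype.card_fin] at h
  omega

/-- **`s(n) = 0 ⟺ det M = 1`**, even `n = 2p₁⋯p_k`, Monsky's `M = (Aᵀ + D₂, D₋₁; D₂, A + D₂)`.
[cite: HeathBrown1994SelmerCongruentII, Appendix (Monsky), typescript p. 41 L20–L36]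
[cite: Smith2016CongruentDensity, §2 proof of Thm. 1.2 (chunk p0005 L65–L75)] -/
theorem monskySelmerRankEven_eq_zero_iff_det :
    monskySelmerRankEven p = 0 ↔ (monskyMatrixEven p).det = 1 := by
  rw [monskySelmerRankEven, det_eq_one_iff_rank_eq_card, Fintype.card_sum, Fintype.card_fin]
  have h := Matrix.rank_le_card_width (monskyMatrixEven p)
  rw [Fintype.card_sum, Fintype.card_fin] at h
  omega

/-! ## §2 `#Sel⁽²⁾(E⁽ⁿ⁾/ℚ) = 4 ⟺ det M = 1 ⟺ rank 0 ∧ Ш[2^∞] = 0` -/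

/-- **Odd `n`: `#Sel⁽²⁾(E⁽ⁿ⁾/ℚ) = 4 ⟺ det M = 1`** (Monsky's formula with equality, a tree theorem).
[cite: HeathBrown1994SelmerCongruentII, Appendix (Monsky), typescript p. 39 L10–L33]
[cite: Smith2016CongruentDensity, §1 Conj. 1.1 / Thm. 1.2 (chunk p0003 L9–L31)] -/
theorem card_selmerGroup_two_eq_four_iff_det_monskyMatrixOdd (hp : ∀ i, (p i).Prime)
    (hodd : ∀ i, Odd (p i)) (hinj : Function.Injective p) :
    Nat.card ((congruentNumberCurve (∏ i, p i)).selmerGroup 2) = 4 ↔ (monskyMatrixOdd p).det = 1 := by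
  rw [monsky_card_selmerGroup_two_odd_holds k p hp hodd hinj, ← monskySelmerRankOdd_eq_zero_iff_det,
    show (4 : ℕ) = 2 ^ 2 by norm_num]
  constructor
  · intro h
    have := Nat.pow_right_injective le_rfl h
    omega
  · intro h
    rw [h]

/-- **Even `n`: `#Sel⁽²⁾(E⁽ⁿ⁾/ℚ) = 4 ⟺ det M = 1`** (Monsky's even formula with equality, a tree theorem).
[cite: HeathBrown1994SelmerCongruentII, Appendix (Monsky), typescript p. 41 L20–L36]
[cite: Smith2016CongruentDensity, §1 Conj. 1.1 / Thm. 1.2 (chunk p0003 L9–L31)] -/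
theorem card_selmerGroup_two_eq_four_iff_det_monskyMatrixEven (hp : ∀ i, (p i).Prime)
    (hodd : ∀ i, Odd (p i)) (hinj : Function.Injective p) :
    Nat.card ((congruentNumberCurve (2 * ∏ i, p i)).selmerGroup 2) = 4 ↔ (monskyMatrixEven p).det = 1 := by
  rw [monsky_card_selmerGroup_two_even_holds k p hp hodd hinj, ← monskySelmerRankEven_eq_zero_iff_det,
    show (4 : ℕ) = 2 ^ 2 by norm_num]
  constructor
  · intro h
    have := Nat.pow_right_injective le_rfl h
    omega
  · intro h
    rw [h]

/-- **Odd `n`: `rank E⁽ⁿ⁾(ℚ) = 0 ∧ Ш(E⁽ⁿ⁾/ℚ)[2^∞] = 0 ⟺ det M = 1`**, unconditionally, every `k`.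
[cite: Smith2016CongruentDensity, Thm. 1.2 (chunk p0003 L29–L31)] [cite: TianYuanZhang2017, Thm. 1.2 (journal numbering)]
[cite: SilvermanAEC2009, Thm. X.4.2] -/
theorem rank_zero_and_sha_iff_det_monskyMatrixOdd (hp : ∀ i, (p i).Prime) (hodd : ∀ i, Odd (p i))
    (hinj : Function.Injective p) :
    ((haveI := isElliptic_congruentNumberCurve (Squarefree.ne_zero (squarefree_prod_of_injective p hp hinj));
        (congruentNumberCurve (∏ i, p i)).mordellWeilRank = 0) ∧
      (haveI := isElliptic_congruentNumberCurve (Squarefree.ne_zero (squarefree_prod_of_injective p hp hinj));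
        AddCommGroup.primaryComponent (congruentNumberCurve (∏ i, p i)).sha 2 = ⊥)) ↔
      (monskyMatrixOdd p).det = 1 := by
  rw [← card_selmerGroup_two_eq_four_iff_rank_zero_and_sha
      (Squarefree.ne_zero (squarefree_prod_of_injective p hp hinj)),
    card_selmerGroup_two_eq_four_iff_det_monskyMatrixOdd p hp hodd hinj]

/-- **Even `n`: `rank E⁽ⁿ⁾(ℚ) = 0 ∧ Ш(E⁽ⁿ⁾/ℚ)[2^∞] = 0 ⟺ det M = 1`**, unconditionally, every `k`.
[cite: Smith2016CongruentDensity, Thm. 1.2 (chunk p0003 L29–L31)] [cite: TianYuanZhang2017, Thm. 1.2 (journal numbering)]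
[cite: SilvermanAEC2009, Thm. X.4.2] -/
theorem rank_zero_and_sha_iff_det_monskyMatrixEven (hp : ∀ i, (p i).Prime) (hodd : ∀ i, Odd (p i))
    (hinj : Function.Injective p) :
    ((haveI := isElliptic_congruentNumberCurve
        (Squarefree.ne_zero (squarefree_two_mul_prod_of_injective p hp hodd hinj));
        (congruentNumberCurve (2 * ∏ i, p i)).mordellWeilRank = 0) ∧
      (haveI := isElliptic_congruentNumberCurve
        (Squarefree.ne_zero (squarefree_two_mul_prod_of_injective p hp hodd hinj));
        AddCommGroup.primaryComponent (congruentNumberCurve (2 * ∏ i, p i)).sha 2 = ⊥)) ↔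
      (monskyMatrixEven p).det = 1 := by
  rw [← card_selmerGroup_two_eq_four_iff_rank_zero_and_sha
      (Squarefree.ne_zero (squarefree_two_mul_prod_of_injective p hp hodd hinj)),
    card_selmerGroup_two_eq_four_iff_det_monskyMatrixEven p hp hodd hinj]

/-- `N`-form, odd `n` (`∏ pᵢ = N`). [cite: Smith2016CongruentDensity, Thm. 1.2 (chunk p0003 L29–L31)] -/
theorem card_selmerGroup_two_eq_four_iff_det_monskyMatrixOdd' {N : ℕ} (hn : ∏ i, p i = N)
    (hp : ∀ i, (p i).Prime) (hodd : ∀ i, Odd (p i)) (hinj : Function.Injective p) :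
    Nat.card ((congruentNumberCurve N).selmerGroup 2) = 4 ↔ (monskyMatrixOdd p).det = 1 := by
  subst hn; exact card_selmerGroup_two_eq_four_iff_det_monskyMatrixOdd p hp hodd hinj

/-- `N`-form, even `n` (`2 ∏ pᵢ = N`). [cite: Smith2016CongruentDensity, Thm. 1.2 (chunk p0003 L29–L31)] -/
theorem card_selmerGroup_two_eq_four_iff_det_monskyMatrixEven' {N : ℕ} (hn : 2 * ∏ i, p i = N)
    (hp : ∀ i, (p i).Prime) (hodd : ∀ i, Odd (p i)) (hinj : Function.Injective p) :
    Nat.card ((congruentNumberCurve N).selmerGroup 2) = 4 ↔ (monskyMatrixEven p).det = 1 := by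
  subst hn; exact card_selmerGroup_two_eq_four_iff_det_monskyMatrixEven p hp hodd hinj

/-! ## §3 `det M = 0` on the root-number `−1` classes `n ≡ 5, 6, 7 (mod 8)` -/

/-- **For odd `n ≡ 5, 7 (mod 8)`, `det M = 0`**: `s(n)` is odd (Monsky's parity theorem, tree theorem).
[cite: HeathBrown1994SelmerCongruentII, Appendix (Monsky), Theorem, typescript p. 38 L5–L7]
[cite: Smith2016CongruentDensity, §2 proof of Thm. 1.2 (chunk p0005 L75)] -/
theorem det_monskyMatrixOdd_eq_zero_of_mod_eight (hp : ∀ i, (p i).Prime) (hodd : ∀ i, Odd (p i))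
    (hinj : Function.Injective p) (h57 : (∏ i, p i) % 8 = 5 ∨ (∏ i, p i) % 8 = 7) :
    (monskyMatrixOdd p).det = 0 := by
  rw [det_eq_zero_iff_ne_one, Ne, ← monskySelmerRankOdd_eq_zero_iff_det]
  intro h0
  have hsodd : Odd (monskySelmerRankOdd p) :=
    (odd_monskySelmerRankOdd_iff p hp (ne_two_of_odd p hodd) hinj).mpr h57
  rw [h0] at hsodd
  exact (by decide : ¬ Odd 0) hsodd

/-- **For even `n ≡ 6 (mod 8)`, `det M = 0`**: `s(n)` is odd (Monsky's parity theorem, even case).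
[cite: HeathBrown1994SelmerCongruentII, Appendix (Monsky), Theorem, typescript p. 38 L5–L7; p. 41 L20–L36]
[cite: Smith2016CongruentDensity, §2 proof of Thm. 1.2 (chunk p0005 L75)] -/
theorem det_monskyMatrixEven_eq_zero_of_mod_eight_six (hp : ∀ i, (p i).Prime) (hodd : ∀ i, Odd (p i))
    (hinj : Function.Injective p) (h6 : (2 * ∏ i, p i) % 8 = 6) :
    (monskyMatrixEven p).det = 0 := by
  rw [det_eq_zero_iff_ne_one, Ne, ← monskySelmerRankEven_eq_zero_iff_det]
  intro h0
  have hsodd : Odd (monskySelmerRankEven p) :=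
    (odd_monskySelmerRankEven_iff p hp (ne_two_of_odd p hodd) hinj).mpr h6
  rw [h0] at hsodd
  exact (by decide : ¬ Odd 0) hsodd

/-- **Root number `−1` ⟹ not (rank `0` and `Ш[2^∞] = 0)**, odd `n ≡ 5, 7 (mod 8)`: `E⁽ⁿ⁾` has positive rank or
non-trivial `Ш[2^∞]`, unconditionally (from `2`-Selmer parity; no `L`-function).
[cite: HeathBrown1994SelmerCongruentII, Appendix (Monsky), Theorem, typescript p. 38 L5–L7]
[cite: Smith2016CongruentDensity, §2 (chunk p0005 L75: "both sides of Conjecture 1.1 fail")] -/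
theorem mordellWeilRank_pos_or_sha_ne_bot_of_mod_eight (hp : ∀ i, (p i).Prime) (hodd : ∀ i, Odd (p i))
    (hinj : Function.Injective p) (h57 : (∏ i, p i) % 8 = 5 ∨ (∏ i, p i) % 8 = 7) :
    (haveI := isElliptic_congruentNumberCurve (Squarefree.ne_zero (squarefree_prod_of_injective p hp hinj));
        0 < (congruentNumberCurve (∏ i, p i)).mordellWeilRank) ∨
      (haveI := isElliptic_congruentNumberCurve (Squarefree.ne_zero (squarefree_prod_of_injective p hp hinj));
        AddCommGroup.primaryComponent (congruentNumberCurve (∏ i, p i)).sha 2 ≠ ⊥) := by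
  have h := rank_zero_and_sha_iff_det_monskyMatrixOdd p hp hodd hinj
  rw [det_monskyMatrixOdd_eq_zero_of_mod_eight p hp hodd hinj h57] at h
  have hn : ¬ ((_ : Prop) ∧ _) := fun hc => zero_ne_one (h.mp hc)
  rw [not_and_or] at hn
  rcases hn with h1 | h1
  · exact Or.inl (Nat.pos_of_ne_zero h1)
  · exact Or.inr h1

/-- **Root number `−1` ⟹ not (rank `0` and `Ш[2^∞] = 0)**, even `n ≡ 6 (mod 8)`.
[cite: HeathBrown1994SelmerCongruentII, Appendix (Monsky), Theorem, typescript p. 38 L5–L7]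
[cite: Smith2016CongruentDensity, §2 (chunk p0005 L75)] -/
theorem mordellWeilRank_pos_or_sha_ne_bot_of_mod_eight_six (hp : ∀ i, (p i).Prime)
    (hodd : ∀ i, Odd (p i)) (hinj : Function.Injective p) (h6 : (2 * ∏ i, p i) % 8 = 6) :
    (haveI := isElliptic_congruentNumberCurve
        (Squarefree.ne_zero (squarefree_two_mul_prod_of_injective p hp hodd hinj));
        0 < (congruentNumberCurve (2 * ∏ i, p i)).mordellWeilRank) ∨
      (haveI := isElliptic_congruentNumberCurve
        (Squarefree.ne_zero (squarefree_two_mul_prod_of_injective p hp hodd hinj));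
        AddCommGroup.primaryComponent (congruentNumberCurve (2 * ∏ i, p i)).sha 2 ≠ ⊥) := by
  have h := rank_zero_and_sha_iff_det_monskyMatrixEven p hp hodd hinj
  rw [det_monskyMatrixEven_eq_zero_of_mod_eight_six p hp hodd hinj h6] at h
  have hn : ¬ ((_ : Prop) ∧ _) := fun hc => zero_ne_one (h.mp hc)
  rw [not_and_or] at hn
  rcases hn with h1 | h1
  · exact Or.inl (Nat.pos_of_ne_zero h1)
  · exact Or.inr h1

end Literature.NumberTheory.EllipticCurves.Smith2016
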